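import Summits.ValiantsHypothesis.ValiantsHypothesis.Theorems.LacunarySymmetroidMatrixDescartesFiniteSectorStampCeilingMTwoTenA
import Summits.ValiantsHypothesis.ValiantsHypothesis.Theorems.LacunarySymmetroidMatrixDescartesFiniteSectorSectorCeilingMTwo

/-!
# `MatrixDescartes` — line «stamp»: the STAMP CEILING `ν(2,10) ≤ 40 = n(2,9)` (kernel) — `StampLawAt 2 10 40`

HONEST FRAMING.  Object-search cell `pub-symmetroid`, seat val-sym-door-p5 g8.  HELPER of the crux item `stmt-ValiantsHypothesis-18050` with NO closure
claim.  Continuation of `…FiniteSectorStampCeilingMTwo` / `…MTwoHigh` / `…MTwoNine` (`StampLawAt 2 K n(2,K−1)` for `K ≤ 9`): T3 (`mem_sumset_of_fullPos`) makes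
every `r ≤ deg` a pair sum `dᵢ + dⱼ`; the finite core — no `9` denominations cover `[0, 41]` — has 56788 live prefixes (a sorted prefix fixes all pair sums below the
next value, `memP_prefix`) and is decided in the kernel in SLICES by the third value `a ∈ {2,3}` (forced by the cover at `3`): slice(s)
(2) in `…FiniteSectorStampCeilingMTwoTenA`, slice(s) (3) here,
pair sums as shift-form bitmasks (`…FiniteSectorPairSumMasksShift`).  Result: `stampLawAt_two_ten : StampLawAt 2 10 40` — the classical two-stamp postage number
`n(2,9) = 40` (OEIS A001212) as a DEGREE CEILING for full-positive-rooted symmetric `2 × 2` half-pencils with `10` terms.  Located first (exact DFS, this seat):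
best reach of `9` denominations = `40` (e.g. {1,3,4,9,11,16,17,19,20}).  Nothing here bears on the crux (asymptotic), on the doors, or on `VP ≠ VNP`.
[folklore] Postage-stamp bookkeeping on the proved T3; no citation is load-bearing.
-/

-- `Summit.ValiantsHypothesis.ValiantsHypothesis.…` repeats a component by the D-0017 layout
-- (single-conjunct summit), which the `dupNamespace` linter flags; the name is mandated.
set_option linter.dupNamespace false

namespace Summit.ValiantsHypothesis.ValiantsHypothesis.Theorems.LacunarySymmetroidMatrixDescartes.FiniteSector

open scoped BigOperators Matrix
open Polynomial

/-! ## `K = 10`: `ν(2,10) ≤ n(2,9) = 40` — last slice and the transfer -/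

set_option synthInstance.maxSize 2000000 in
set_option synthInstance.maxHeartbeats 2000000 in
set_option maxHeartbeats 4000000 in
/-- **Finite core of `n(2,9) = 40`, slice `(a = 3)`** (22212 live prefixes; pruned nested enumeration over the remaining sorted values
`< 43`, pair sums as shift-form bitmasks, `decide` in the kernel): prefixes covering `[0, next)` by pair sums never cover `[0, 41]`. [folklore] -/
theorem stampCheck_two_ten_s3 :
    ∀ b ∈ List.range 43, (3 < b ∧ (List.foldr (fun x acc => acc ||| (List.foldr (fun y acc => acc ||| 2 ^ y) 0 [0, 1, 3]) * 2 ^ x) 0 [0, 1, 3] % 2 ^ (min 42 b) = 2 ^ (min 42 b) - 1)) →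
    ∀ c ∈ List.range 43, (b < c ∧ (List.foldr (fun x acc => acc ||| (List.foldr (fun y acc => acc ||| 2 ^ y) 0 [0, 1, 3, b]) * 2 ^ x) 0 [0, 1, 3, b] % 2 ^ (min 42 c) = 2 ^ (min 42 c) - 1)) →
    ∀ e ∈ List.range 43, (c < e ∧ (List.foldr (fun x acc => acc ||| (List.foldr (fun y acc => acc ||| 2 ^ y) 0 [0, 1, 3, b, c]) * 2 ^ x) 0 [0, 1, 3, b, c] % 2 ^ (min 42 e) = 2 ^ (min 42 e) - 1)) →
    ∀ f ∈ List.range 43, (e < f ∧ (List.foldr (fun x acc => acc ||| (List.foldr (fun y acc => acc ||| 2 ^ y) 0 [0, 1, 3, b, c, e]) * 2 ^ x) 0 [0, 1, 3, b, c, e] % 2 ^ (min 42 f) = 2 ^ (min 42 f) - 1)) →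
    ∀ g ∈ List.range 43, (f < g ∧ (List.foldr (fun x acc => acc ||| (List.foldr (fun y acc => acc ||| 2 ^ y) 0 [0, 1, 3, b, c, e, f]) * 2 ^ x) 0 [0, 1, 3, b, c, e, f] % 2 ^ (min 42 g) = 2 ^ (min 42 g) - 1)) →
    ∀ k ∈ List.range 43, (g < k ∧ (List.foldr (fun x acc => acc ||| (List.foldr (fun y acc => acc ||| 2 ^ y) 0 [0, 1, 3, b, c, e, f, g]) * 2 ^ x) 0 [0, 1, 3, b, c, e, f, g] % 2 ^ (min 42 k) = 2 ^ (min 42 k) - 1)) →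
    ∀ m ∈ List.range 43, (k < m ∧ (List.foldr (fun x acc => acc ||| (List.foldr (fun y acc => acc ||| 2 ^ y) 0 [0, 1, 3, b, c, e, f, g, k]) * 2 ^ x) 0 [0, 1, 3, b, c, e, f, g, k] % 2 ^ (min 42 m) = 2 ^ (min 42 m) - 1)) →
    ¬ (List.foldr (fun x acc => acc ||| (List.foldr (fun y acc => acc ||| 2 ^ y) 0 [0, 1, 3, b, c, e, f, g, k, m]) * 2 ^ x) 0 [0, 1, 3, b, c, e, f, g, k, m] % 2 ^ 42 = 2 ^ 42 - 1) := by
  decide +kernel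

/-- **`ν(2,10) ≤ 40 = n(2,9)`** — `StampLawAt 2 10 40`: every full-positive-rooted symmetric `2 × 2` half-pencil determinant with `10` terms has
degree `≤ 40` (T3 ⇒ every `r ≤ deg` is a pair sum; values `0, 1` forced; capped at `42`, padded, sorted; `a ≤ 3` from the cover at `3`; shift-form masks;
the slice checks). [folklore] -/
theorem stampLawAt_two_ten : StampLawAt 2 10 40 := by
  intro d S hS hfull
  by_contra hdeg'
  have hdeg : 40 < (pencil d S).det.natDegree := not_le.mp hdeg'
  have hq : (pencil d S).det ≠ 0 := by
    intro h0
    rw [h0] at hdeg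
    simp at hdeg
  have hmem : ∀ r, r ≤ (pencil d S).det.natDegree → ∃ i j : Fin 10, d i + d j = r := by
    intro r hr
    have hm := mem_sumset_of_fullPos d S hq hfull hr
    rw [Finset.mem_image] at hm
    obtain ⟨s, -, hs⟩ := hm
    have hcard2 : Multiset.card (s : Multiset (Fin 10)) = 2 := s.2
    obtain ⟨i, j, hij⟩ := Multiset.card_eq_two.mp hcard2
    refine ⟨i, j, ?_⟩
    have hsum : ((s : Multiset (Fin 10)).map d).sum = d i + d j := by
      rw [hij]
      simp
    omega
  set cv : Fin 10 → ℕ := fun i => min (d i) 42 with hcv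
  have hcvd : ∀ i, d i ≤ 41 → cv i = d i := fun i hi => by
    simp only [hcv]
    exact Nat.min_eq_left (by omega)
  have hcvle : ∀ i, cv i ≤ 42 := fun i => Nat.min_le_right _ _
  set V : Finset ℕ := Finset.univ.image cv with hV
  have hcvV : ∀ i, cv i ∈ V := fun i => Finset.mem_image_of_mem cv (Finset.mem_univ i)
  have h0V : 0 ∈ V := by
    obtain ⟨i, j, hij⟩ := hmem 0 (Nat.zero_le _)
    have : cv i = 0 := by rw [hcvd i (by omega)]; omega
    exact this ▸ hcvV i
  have h1V : 1 ∈ V := by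
    obtain ⟨i, j, hij⟩ := hmem 1 (by omega)
    rcases Nat.eq_zero_or_pos (d i) with hi | hi
    · have : cv j = 1 := by rw [hcvd j (by omega)]; omega
      exact this ▸ hcvV j
    · have : cv i = 1 := by rw [hcvd i (by omega)]; omega
      exact this ▸ hcvV i
  have h1V' : 1 ∈ V.erase 0 := Finset.mem_erase.mpr ⟨by norm_num, h1V⟩
  set W : Finset ℕ := (V.erase 0).erase 1 with hW
  have hWsub : W ⊆ ((Finset.range 43).erase 0).erase 1 := by
    intro u hu
    rw [hW, Finset.mem_erase, Finset.mem_erase] at hu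
    obtain ⟨hu1, hu0, huV⟩ := hu
    rw [hV, Finset.mem_image] at huV
    obtain ⟨i, -, rfl⟩ := huV
    rw [Finset.mem_erase, Finset.mem_erase, Finset.mem_range]
    exact ⟨hu1, hu0, Nat.lt_succ_of_le (hcvle i)⟩
  have hWcard : W.card ≤ 8 := by
    have hVK : V.card ≤ 10 := by
      have := Finset.card_image_le (s := (Finset.univ : Finset (Fin 10))) (f := cv)
      simpa using this
    have h1 : (V.erase 0).card + 1 = V.card := Finset.card_erase_add_one h0V
    have h2 : W.card + 1 = (V.erase 0).card := by rw [hW]; exact Finset.card_erase_add_one h1V'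
    omega
  obtain ⟨W', hWW', hW'sub, hW'card⟩ := Finset.exists_subsuperset_card_eq hWsub hWcard (by
    rw [Finset.card_erase_of_mem (by simp), Finset.card_erase_of_mem (by simp), Finset.card_range]; omega)
  have hVW' : ∀ u ∈ V, u = 0 ∨ u = 1 ∨ u ∈ W' := by
    intro u hu
    by_cases hu0 : u = 0
    · exact Or.inl hu0
    by_cases hu1 : u = 1
    · exact Or.inr (Or.inl hu1)
    · exact Or.inr (Or.inr (hWW' (by rw [hW, Finset.mem_erase, Finset.mem_erase]; exact ⟨hu1, hu0, hu⟩)))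
  have hlmem : ∀ u, u ∈ Finset.sort W' ↔ u ∈ W' := fun u => Finset.mem_sort _
  have hlsort : (Finset.sort W').SortedLT := Finset.sortedLT_sort W'
  have hllen : (Finset.sort W').length = 8 := by rw [Finset.length_sort, hW'card]
  generalize hl : Finset.sort W' = l at hlmem hlsort hllen
  rcases l with _ | ⟨a, _ | ⟨b, _ | ⟨c, _ | ⟨e, _ | ⟨f, _ | ⟨g, _ | ⟨k, _ | ⟨m, _ | ⟨zz, ll⟩⟩⟩⟩⟩⟩⟩⟩⟩
  all_goals simp only [List.length_cons, List.length_nil] at hllen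
  all_goals try omega
  have hmemR : ∀ u, u ∈ [a, b, c, e, f, g, k, m] → u ∈ List.range 43 := by
    intro u hu
    have hu' : u ∈ W' := (hlmem u).mp hu
    have := hW'sub hu'
    rw [Finset.mem_erase, Finset.mem_erase, Finset.mem_range] at this
    exact List.mem_range.mpr this.2.2
  have hgt1 : ∀ u, u ∈ [a, b, c, e, f, g, k, m] → 1 < u := by
    intro u hu
    have hu' : u ∈ W' := (hlmem u).mp hu
    have := hW'sub hu'
    rw [Finset.mem_erase, Finset.mem_erase] at this
    omega
  have h1a : 1 < a := hgt1 a (by simp)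
  have hmemP : ∀ r, r ≤ 41 → (∃ i j : Fin 10, d i + d j = r) → (∃ x ∈ [0, 1, a, b, c, e, f, g, k, m], ∃ y ∈ [0, 1, a, b, c, e, f, g, k, m], x + y = r) := by
    rintro r hr ⟨i, j, hij⟩
    have hi : cv i = d i := hcvd i (by omega)
    have hj : cv j = d j := hcvd j (by omega)
    have hin : ∀ u ∈ V, u ∈ [0, 1, a, b, c, e, f, g, k, m] := by
      intro u hu
      rcases hVW' u hu with h | h | h
      · rw [h]; simp
      · rw [h]; simp
      · exact List.mem_cons_of_mem _ (List.mem_cons_of_mem _ ((hlmem u).mpr h))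
    exact ⟨cv i, hin _ (hcvV i), cv j, hin _ (hcvV j), by rw [hi, hj]; exact hij⟩
  have hcovP : ∀ r, r ≤ 41 → (∃ x ∈ [0, 1, a, b, c, e, f, g, k, m], ∃ y ∈ [0, 1, a, b, c, e, f, g, k, m], x + y = r) := fun r hr => hmemP r hr (hmem r (by omega))
  have hlt1 : a < b := by
    have := hlsort (show (⟨0, by simp⟩ : Fin [a, b, c, e, f, g, k, m].length) < ⟨1, by simp⟩ from Fin.mk_lt_mk.mpr (by norm_num))
    simpa using this
  have hlt2 : b < c := by
    have := hlsort (show (⟨1, by simp⟩ : Fin [a, b, c, e, f, g, k, m].length) < ⟨2, by simp⟩ from Fin.mk_lt_mk.mpr (by norm_num))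
    simpa using this
  have hlt3 : c < e := by
    have := hlsort (show (⟨2, by simp⟩ : Fin [a, b, c, e, f, g, k, m].length) < ⟨3, by simp⟩ from Fin.mk_lt_mk.mpr (by norm_num))
    simpa using this
  have hlt4 : e < f := by
    have := hlsort (show (⟨3, by simp⟩ : Fin [a, b, c, e, f, g, k, m].length) < ⟨4, by simp⟩ from Fin.mk_lt_mk.mpr (by norm_num))
    simpa using this
  have hlt5 : f < g := by
    have := hlsort (show (⟨4, by simp⟩ : Fin [a, b, c, e, f, g, k, m].length) < ⟨5, by simp⟩ from Fin.mk_lt_mk.mpr (by norm_num))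
    simpa using this
  have hlt6 : g < k := by
    have := hlsort (show (⟨5, by simp⟩ : Fin [a, b, c, e, f, g, k, m].length) < ⟨6, by simp⟩ from Fin.mk_lt_mk.mpr (by norm_num))
    simpa using this
  have hlt7 : k < m := by
    have := hlsort (show (⟨6, by simp⟩ : Fin [a, b, c, e, f, g, k, m].length) < ⟨7, by simp⟩ from Fin.mk_lt_mk.mpr (by norm_num))
    simpa using this
  -- the third value: `a ≤ 3` (the cover at `3` below `a` uses only `0, 1`)
  have hrestA : ∀ y ∈ [a, b, c, e, f, g, k, m], a ≤ y := by
    intro y hy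
    simp only [List.mem_cons, List.mem_nil_iff, or_false] at hy
    omega
  have ha3 : a ≤ 3 := by
    by_contra hh
    obtain ⟨x, hx, y, hy, hxy⟩ := memP_prefix (l₁ := [0, 1]) (l₂ := [a, b, c, e, f, g, k, m]) hrestA (show 3 < a by omega) (hcovP 3 (by omega))
    simp only [List.mem_cons, List.mem_nil_iff, or_false] at hx hy
    omega
  have pre2 : (List.foldr (fun x acc => acc ||| (List.foldr (fun y acc => acc ||| 2 ^ y) 0 [0, 1, a]) * 2 ^ x) 0 [0, 1, a] % 2 ^ (min 42 b) = 2 ^ (min 42 b) - 1) := by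
    apply maskFull_of_testBit
    intro r hr
    have hrN : r < 42 := lt_of_lt_of_le hr (min_le_left _ _)
    have hrv : r < b := lt_of_lt_of_le hr (min_le_right _ _)
    have hrest : ∀ y ∈ [b, c, e, f, g, k, m], b ≤ y := by
      intro y hy
      simp only [List.mem_cons, List.mem_nil_iff, or_false] at hy
      omega
    exact testBit_pairFoldShift_of_mem (memP_prefix (l₁ := [0, 1, a]) (l₂ := [b, c, e, f, g, k, m]) hrest hrv (hcovP r (by omega)))
  have pre3 : (List.foldr (fun x acc => acc ||| (List.foldr (fun y acc => acc ||| 2 ^ y) 0 [0, 1, a, b]) * 2 ^ x) 0 [0, 1, a, b] % 2 ^ (min 42 c) = 2 ^ (min 42 c) - 1) := by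
    apply maskFull_of_testBit
    intro r hr
    have hrN : r < 42 := lt_of_lt_of_le hr (min_le_left _ _)
    have hrv : r < c := lt_of_lt_of_le hr (min_le_right _ _)
    have hrest : ∀ y ∈ [c, e, f, g, k, m], c ≤ y := by
      intro y hy
      simp only [List.mem_cons, List.mem_nil_iff, or_false] at hy
      omega
    exact testBit_pairFoldShift_of_mem (memP_prefix (l₁ := [0, 1, a, b]) (l₂ := [c, e, f, g, k, m]) hrest hrv (hcovP r (by omega)))
  have pre4 : (List.foldr (fun x acc => acc ||| (List.foldr (fun y acc => acc ||| 2 ^ y) 0 [0, 1, a, b, c]) * 2 ^ x) 0 [0, 1, a, b, c] % 2 ^ (min 42 e) = 2 ^ (min 42 e) - 1) := by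
    apply maskFull_of_testBit
    intro r hr
    have hrN : r < 42 := lt_of_lt_of_le hr (min_le_left _ _)
    have hrv : r < e := lt_of_lt_of_le hr (min_le_right _ _)
    have hrest : ∀ y ∈ [e, f, g, k, m], e ≤ y := by
      intro y hy
      simp only [List.mem_cons, List.mem_nil_iff, or_false] at hy
      omega
    exact testBit_pairFoldShift_of_mem (memP_prefix (l₁ := [0, 1, a, b, c]) (l₂ := [e, f, g, k, m]) hrest hrv (hcovP r (by omega)))
  have pre5 : (List.foldr (fun x acc => acc ||| (List.foldr (fun y acc => acc ||| 2 ^ y) 0 [0, 1, a, b, c, e]) * 2 ^ x) 0 [0, 1, a, b, c, e] % 2 ^ (min 42 f) = 2 ^ (min 42 f) - 1) := by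
    apply maskFull_of_testBit
    intro r hr
    have hrN : r < 42 := lt_of_lt_of_le hr (min_le_left _ _)
    have hrv : r < f := lt_of_lt_of_le hr (min_le_right _ _)
    have hrest : ∀ y ∈ [f, g, k, m], f ≤ y := by
      intro y hy
      simp only [List.mem_cons, List.mem_nil_iff, or_false] at hy
      omega
    exact testBit_pairFoldShift_of_mem (memP_prefix (l₁ := [0, 1, a, b, c, e]) (l₂ := [f, g, k, m]) hrest hrv (hcovP r (by omega)))
  have pre6 : (List.foldr (fun x acc => acc ||| (List.foldr (fun y acc => acc ||| 2 ^ y) 0 [0, 1, a, b, c, e, f]) * 2 ^ x) 0 [0, 1, a, b, c, e, f] % 2 ^ (min 42 g) = 2 ^ (min 42 g) - 1) := by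
    apply maskFull_of_testBit
    intro r hr
    have hrN : r < 42 := lt_of_lt_of_le hr (min_le_left _ _)
    have hrv : r < g := lt_of_lt_of_le hr (min_le_right _ _)
    have hrest : ∀ y ∈ [g, k, m], g ≤ y := by
      intro y hy
      simp only [List.mem_cons, List.mem_nil_iff, or_false] at hy
      omega
    exact testBit_pairFoldShift_of_mem (memP_prefix (l₁ := [0, 1, a, b, c, e, f]) (l₂ := [g, k, m]) hrest hrv (hcovP r (by omega)))
  have pre7 : (List.foldr (fun x acc => acc ||| (List.foldr (fun y acc => acc ||| 2 ^ y) 0 [0, 1, a, b, c, e, f, g]) * 2 ^ x) 0 [0, 1, a, b, c, e, f, g] % 2 ^ (min 42 k) = 2 ^ (min 42 k) - 1) := by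
    apply maskFull_of_testBit
    intro r hr
    have hrN : r < 42 := lt_of_lt_of_le hr (min_le_left _ _)
    have hrv : r < k := lt_of_lt_of_le hr (min_le_right _ _)
    have hrest : ∀ y ∈ [k, m], k ≤ y := by
      intro y hy
      simp only [List.mem_cons, List.mem_nil_iff, or_false] at hy
      omega
    exact testBit_pairFoldShift_of_mem (memP_prefix (l₁ := [0, 1, a, b, c, e, f, g]) (l₂ := [k, m]) hrest hrv (hcovP r (by omega)))
  have pre8 : (List.foldr (fun x acc => acc ||| (List.foldr (fun y acc => acc ||| 2 ^ y) 0 [0, 1, a, b, c, e, f, g, k]) * 2 ^ x) 0 [0, 1, a, b, c, e, f, g, k] % 2 ^ (min 42 m) = 2 ^ (min 42 m) - 1) := by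
    apply maskFull_of_testBit
    intro r hr
    have hrN : r < 42 := lt_of_lt_of_le hr (min_le_left _ _)
    have hrv : r < m := lt_of_lt_of_le hr (min_le_right _ _)
    have hrest : ∀ y ∈ [m], m ≤ y := by
      intro y hy
      simp only [List.mem_cons, List.mem_nil_iff, or_false] at hy
      omega
    exact testBit_pairFoldShift_of_mem (memP_prefix (l₁ := [0, 1, a, b, c, e, f, g, k]) (l₂ := [m]) hrest hrv (hcovP r (by omega)))
  have hcovT : (List.foldr (fun x acc => acc ||| (List.foldr (fun y acc => acc ||| 2 ^ y) 0 [0, 1, a, b, c, e, f, g, k, m]) * 2 ^ x) 0 [0, 1, a, b, c, e, f, g, k, m] % 2 ^ 42 = 2 ^ 42 - 1) :=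
    maskFull_of_testBit (fun r hr => testBit_pairFoldShift_of_mem (hcovP r (by omega)))
  interval_cases a <;> first | exact stampCheck_two_ten_s2 b (hmemR b (by simp)) ⟨hlt1, pre2⟩ c (hmemR c (by simp)) ⟨hlt2, pre3⟩ e (hmemR e (by simp)) ⟨hlt3, pre4⟩ f (hmemR f (by simp)) ⟨hlt4, pre5⟩ g (hmemR g (by simp)) ⟨hlt5, pre6⟩ k (hmemR k (by simp)) ⟨hlt6, pre7⟩ m (hmemR m (by simp)) ⟨hlt7, pre8⟩ hcovT | exact stampCheck_two_ten_s3 b (hmemR b (by simp)) ⟨hlt1, pre2⟩ c (hmemR c (by simp)) ⟨hlt2, pre3⟩ e (hmemR e (by simp)) ⟨hlt3, pre4⟩ f (hmemR f (by simp)) ⟨hlt4, pre5⟩ g (hmemR g (by simp)) ⟨hlt5, pre6⟩ k (hmemR k (by simp)) ⟨hlt6, pre7⟩ m (hmemR m (by simp)) ⟨hlt7, pre8⟩ hcovT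

end Summit.ValiantsHypothesis.ValiantsHypothesis.Theorems.LacunarySymmetroidMatrixDescartes.FiniteSector
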